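import Summits.Ventures.PercRepro.C041EdgeDict
import Summits.Ventures.PercRepro.C041CycleZone
import Summits.Ventures.PercRepro.C041TriangleMarkLeaf

/-!
# ROW C-041 — THE EDGE-LEAF ON THE GRAPH MODEL: the fugacity-½ leaf `v ½` is (four times) the six-vector of the
`(1,1)`-vertex hung by one edge, and every cycle with a marked vertex and such a leaf satisfies the ZONE O-CUBE (p6,
gen 31; mine-3's C-041.md §21 (ag)/(aj): «every marked vertex against every deformed leaf is in the cone»)

`edgeLeaf := pendant K₂ true (pointZone 1 1) ()` — the `(1,1)`-vertex at the far end of one edge, anchored at the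
near end.  By THE EDGE DICTIONARY its six-vector is `ℓψ(X(1,1)) = (4, 5, 5, 1, 2, 2) = 4 · v ½`
(`sixVec_edgeLeaf`): the unweighted edge IS the fugacity `s = 1`, `a = s/(1+s) = ½`.  Hence, through THE CYCLE
DICTIONARY and mine-3's `InCone_thetaTri_marks_v` (`C041TriangleMarkLeaf`), every cycle through the anchor
carrying a marked vertex `X(p, q)` at `x_i` and the edge-leaf at `x_j` is in the cone
(`inCone_sixVec_cyc2_point_leaf`) and satisfies the ZONE O-CUBE (`zoneOCubeConj_cyc2_point_leaf`) — the first
graph-model family beyond the marked points with a genuinely two-level zone at an exit of a cycle.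
-/

namespace PercRepro

namespace ZoneZ

namespace TwoExit

open ZoneData TreeClosure RelaxedTriangle Pendant PointZone Finset

/-- THE EDGE-LEAF: the `(1,1)`-vertex hung by one edge, anchored at the other end. -/
noncomputable abbrev edgeLeaf : ZoneData (Bool ⊕ Unit) (Unit ⊕ Empty) (Fin 1) (Fin 1) :=
  pendant AZone.K₂ true (pointZone 1 1) ()

/-- **The six-vector of the edge-leaf is four times the fugacity-½ leaf `v ½`.** -/
theorem sixVec_edgeLeaf : edgeLeaf.sixVec (Sum.inl false) = (4 : ℝ) • v (1 / 2) := by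
  rw [sixVec_edgePendant, sixVec_pointZone]
  funext i
  fin_cases i <;> simp [ellv, ell, v] <;> norm_num

variable (n : ℕ) (i j : Fin (n + 1))

/-- **The cycle with a marked vertex and an edge-leaf is in the cone.** -/
theorem inCone_sixVec_cyc2_point_leaf (hi : 0 < i.val) (hij : i.val < j.val) (p q : ℕ) :
    InCone ((cyc2 n i j (pointZone p q) () edgeLeaf (Sum.inl false)).sixVec (Sum.inl (Sum.inl 0))) := by
  obtain ⟨h₁, h₂, h₃⟩ := arc_lengths n i j hi hij
  rw [sixVec_cyc2 n i j _ _ _ _ hi hij, sixVec_pointZone, sixVec_edgeLeaf, one_mul]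
  have hv : InCone ((4 : ℝ) • v (1 / 2)) := (InCone_v (1 / 2) ⟨by norm_num, by norm_num⟩).smul 4 (by norm_num)
  have ht : InCone (thetaTri (v 1 ^ p * v 0 ^ q) ((4 : ℝ) • v (1 / 2))) := by
    rw [thetaTri_smul_right]
    exact (InCone_thetaTri_marks_v p q (1 / 2) ⟨by norm_num, by norm_num⟩).smul 4 (by norm_num)
  exact InCone_thetaCyc_of_InCone_tri ((InCone_pow_v_one p).mul (InCone_pow_v_zero q)) hv ht
    (mixed_mult_nonneg _ h₁) (mixed_mult_nonneg _ h₂) (mixed_mult_nonneg _ h₃)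

/-- **The ZONE O-CUBE on every cycle with a marked vertex and an edge-leaf.** -/
theorem zoneOCubeConj_cyc2_point_leaf (hi : 0 < i.val) (hij : i.val < j.val) (p q : ℕ) :
    (cyc2 n i j (pointZone p q) () edgeLeaf (Sum.inl false)).ZoneOCubeConj {Sum.inl (Sum.inl 0)}
      (∅ : Set ((Fin (n + 1) ⊕ (Bool ⊕ Unit)) ⊕ Unit)) :=
  (cyc2 n i j (pointZone p q) () edgeLeaf (Sum.inl false)).zoneOCubeConj_of_inCone_sixVec _
    (inCone_sixVec_cyc2_point_leaf n i j hi hij p q)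

/-- The one-anchor (CS) on every cycle with a marked vertex and an edge-leaf. -/
theorem zoneCSConj_cyc2_point_leaf (hi : 0 < i.val) (hij : i.val < j.val) (p q : ℕ) :
    (cyc2 n i j (pointZone p q) () edgeLeaf (Sum.inl false)).ZoneCSConj {Sum.inl (Sum.inl 0)}
      (∅ : Set ((Fin (n + 1) ⊕ (Bool ⊕ Unit)) ⊕ Unit)) :=
  (cyc2 n i j (pointZone p q) () edgeLeaf (Sum.inl false)).zoneCSConj_of_inCone_sixVec _
    (inCone_sixVec_cyc2_point_leaf n i j hi hij p q)

end TwoExit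

end ZoneZ

end PercRepro
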